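import Summits.BirchSwinnertonDyer.Rank1Residual.Additive.X3BranchKummerLayerUnitsSum
import Summits.BirchSwinnertonDyer.Rank1Residual.Additive.X3BranchResidualQuotSelmerLayerLowerBound
import HarnessLib

/-!
# X3, the DEGENERATE rows: the U-side LOWER BOUND `3^{#ι} ≤ #U(W[3]/Φ₀)` from an ABSTRACT FAMILY of
# `Σ₀`-units of ANY layer — Kummer classes, membership in Greenberg–Vatsal's `U`, injectivity
# (cell `bsd-eis`, seat `bsd-eis-x3` gen 9; the table-free form of gen 7's
# `X3BranchResidualQuotSelmerLayerLowerBound.lean` and gen 8's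
# `X3BranchResidualQuotSelmerLayerTwoLowerBound.lean`, first brick of the CLASS-LEVEL count
# `3^{σ(S₀)−1} ≤ #U` of x3-MEMO-11; route K1 `AdditiveBranchIMC`, crux `GordTwoRankZeroOffCaseOne`
# — supports only)

HONEST FRAMING (`run/shared/lean/pub/bsd-eis/README.md` §4): the programme's target of record is the
full Birch–Swinnerton-Dyer formula for every `E/ℚ` of analytic rank `≤ 1`; this file is pure
Galois-cohomological tooling for the DEGENERATE X3♯(G-ord, `e = 2`) rows at `p = 3`. THEOREMS ONLY
(no `def`, no named fact, no `sorry`); nothing is booked; no label, tier or count of record moves.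

## Why

gen 7/8 proved `3^{#ι} ≤ #U` from EXPLICIT integer tables (units of `ℚ(ζ₉)⁺`, `ℚ(ζ₂₇)⁺` as
coefficient vectors, one cube certificate per unit, cubic-residue certificates for independence) —
a method whose tables grow as `3^n × 3^n` with the layer `n` and which cannot reach the live rows
423963g2 / 24939a2 (layer 3) and 372555e2 (layer 4). The class-level count of x3-MEMO-11 replaces the
tables by the `S`-unit theorem and the structure of the local units; its Galois-cohomological half is
the present file, which isolates EXACTLY what the arithmetic must supply about a family
`(a_i)_{i ∈ ι}` of algebraic numbers:

* (fixed)  each `a_i` is fixed by a subgroup `G' ≥ ker κ` of `Γ_ℚ` (e.g. `G' = κ⁻¹(3ⁿℤ₃) = Gal(ℚ̄/ℚ_n)`);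
* (unit)   `a_i`, `b_i` are algebraic integers with `a_i b_i = n_i ∈ ℕ`, `n_i ≠ 0`, every prime of
           `n_i` in `Σ₀` (so `a_i` is a `Σ₀`-unit);
* (local)  for EVERY `τ ∈ Γ_ℚ` some cube root of `τ a_i` is fixed by the elements of the inertia group
           `I_{v₃}` (chosen place above `3`) lying in `ker κ` (e.g. because `τ a_i` is a cube in the
           completion at `3` of the layer);
* (indep)  a Galois-theoretic independence: if `γ³ = ∏ a_i^{d_i}` with `γ` fixed by `G'`, then `d = 0`
           (i.e. the `a_i` are `𝔽₃`-independent in `(ℚ̄^{G'})ˣ` modulo cubes).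

## What

* §1 `KummerFamily.kummerSumClass_mem_unramifiedSelmer_of_goodRoots` — under (fixed) for `ker κ`,
  (unit) and (local), the class on `G_{ℚ_∞} = ker κ` of the Kummer cocycle of `∏ β_i^{k_i}`
  (`β_i³ = a_i`) lies in `unramifiedSelmer` (GV's `U` with `Σ₀` relaxed): verbatim gen 8's
  `kummerSumClass_mem_unramifiedSelmer_layerTwo` with the tables replaced by the hypotheses
  (conjugates `τ a_i` are integral by transport along the `𝓞 ℚ`-algebra automorphism `τ`, fixed by
  `ker κ` by normality; cofactor `τ b_i`; inertia away from `3` by gen 7's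
  `smul_eq_self_of_mem_inertia_of_pow_eq_of_dvd`; at `3` by (local)).
* §2 `X3Branch.pow_card_le_natCard_residualQuotSelmer_of_trivialLine_of_family` — for a rational line
  `Φ₀` fixed pointwise (so `Ψ = W[3]/Φ₀` is the `ω`-line): (fixed) for `G' ≥ ker κ`, (unit), (local),
  (indep) ⟹ `3^{#ι} ≤ #U(W[3]/Φ₀)` (`residualQuotSelmer`, assumed finite). Injectivity: a vanishing
  combination class gives a cube root `γ` of `∏ a_i^{d_i}` fixed by `ker κ`
  (`exists_fixed_root_of_coboundary`), hence by `G'` (`smul_eq_self_of_fixed_kerSubgroup`: the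
  cyclotomic character does not die on `ker κ`), and (indep) gives `d = 0`.

References: [GreenbergVatsal2000] §2 pp. 28–30; [SerreLocalFields1979] Ch. X §3 (Kummer theory);
[Washington1997] §13.1; cell file `run/shared/lean/pub/bsd-eis/x3-MEMO-11.md`.
-/

set_option autoImplicit false

noncomputable section

open scoped Classical AddSubgroup NumberField

namespace Summit.BirchSwinnertonDyer.Rank1Residual.Additive

namespace KummerFamily

open NumberField IsDedekindDomain Field WeierstrassCurve Finset
  Literature.NumberTheory.GaloisRepresentations
  Literature.NumberTheory.EllipticCurves
  Literature.NumberTheory.EllipticCurves.GreenbergSelmer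
  Literature.NumberTheory.EllipticCurves.GreenbergVatsal2000
  Literature.NumberTheory.EllipticCurves.Rank1Residual
  Literature.NumberTheory.NumberFields
  Summit.BirchSwinnertonDyer.Rank1Residual.X2.ResidualDevissageModules
  Summit.BirchSwinnertonDyer.Rank1Residual.X2.ResidualDevissageLine
  KummerLineClasses KummerLayerClasses

/-! ### §1 Membership in `U` of the class of a product, from abstract data -/

/-- **Integrality is transported by `Γ_ℚ`.** [folklore] -/
theorem isIntegral_smul {x : AlgebraicClosure ℚ} (hx : IsIntegral (𝓞 ℚ) x)
    (τ : absoluteGaloisGroup ℚ) : IsIntegral (𝓞 ℚ) (τ • x) := by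
  rw [absoluteGaloisGroup.smul_def]
  exact hx.map ((absoluteGaloisGroup.toAlgEquiv ℚ τ).toAlgHom.restrictScalars (𝓞 ℚ))

/-- **An element fixed by a normal subgroup has all its conjugates fixed by it.** [folklore] -/
theorem smul_smul_eq_of_normal {N : Subgroup (absoluteGaloisGroup ℚ)} [hN : N.Normal]
    {x : AlgebraicClosure ℚ} (hx : ∀ σ ∈ N, σ • x = x) (τ : absoluteGaloisGroup ℚ) :
    ∀ σ ∈ N, σ • (τ • x) = τ • x := by
  intro σ hσ
  have hmem : τ⁻¹ * σ * τ⁻¹⁻¹ ∈ N := hN.conj_mem σ hσ τ⁻¹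
  rw [inv_inv] at hmem
  have h := hx _ hmem
  calc σ • τ • x = τ • ((τ⁻¹ * σ * τ) • x) := by
        rw [mul_smul, mul_smul, smul_inv_smul]
    _ = τ • x := by rw [h]

/-- **The class of a product of `Σ₀`-units with good cube roots lies in `U`.** `κ` a `ℤ₃`-extension
of `ℚ`, `Ψ` an `ω`-line with `3 y₀ = 0`, `ζ₃` a primitive cube root of unity; a finite family of
algebraic integers `a_i` fixed by `ker κ`, with integral cofactors `b_i`, `a_i b_i = n_i ≠ 0`, the primes
of `n_i` in `S₀`; for every `τ ∈ Γ_ℚ` a cube root of `τ a_i` fixed by `I_{v₃} ∩ ker κ`; `β_i³ = a_i`.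
Then the class on `ker κ` of a cocycle `F` with `F(h) = m_h y₀`, `h ∏ β_i^{k_i} = ζ₃^{m_h} ∏ β_i^{k_i}`,
lies in `unramifiedSelmer (ker κ) Ψ 3 S₀`. (gen 8's `kummerSumClass_mem_unramifiedSelmer_layerTwo` with
the tables abstracted.) [cite: GreenbergVatsal2000, §2 pp. 28–29] [cite: SerreLocalFields1979, Ch. X §3] -/
theorem kummerSumClass_mem_unramifiedSelmer_of_goodRoots [hp : Fact (Nat.Prime 3)]
    (κ : ZpExtension ℚ 3) (S₀ : Finset (HeightOneSpectrum (𝓞 ℚ)))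
    {Ψ : Type} [AddCommGroup Ψ] [DistribMulAction (absoluteGaloisGroup ℚ) Ψ]
    [TopologicalSpace Ψ] [DiscreteTopology Ψ]
    (hΨ : ∀ (σ : absoluteGaloisGroup ℚ) (y : Ψ),
      σ • y = ((modNCyclotomicCharacter ℚ 3 σ : (ZMod 3)ˣ) : ZMod 3).val • y)
    {y₀ : Ψ} (hy₀3 : 3 • y₀ = 0) {ζ₃ : AlgebraicClosure ℚ} (hζ₃ : IsPrimitiveRoot ζ₃ 3)
    {ι : Type} [Fintype ι] (a b : ι → AlgebraicClosure ℚ)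
    (haint : ∀ i, IsIntegral (𝓞 ℚ) (a i)) (hbint : ∀ i, IsIntegral (𝓞 ℚ) (b i))
    (n : ι → ℕ) (hn0 : ∀ i, n i ≠ 0) (hab : ∀ i, a i * b i = (n i : AlgebraicClosure ℚ))
    (hnS : ∀ i (v : HeightOneSpectrum (𝓞 ℚ)), ((n i : ℕ) : 𝓞 ℚ) ∈ v.asIdeal → v ∈ S₀)
    (haker : ∀ i, ∀ σ ∈ κ.kerSubgroup, σ • a i = a i)
    (hgood : ∀ i (τ : absoluteGaloisGroup ℚ), ∃ βτ : AlgebraicClosure ℚ, βτ ^ 3 = τ • a i ∧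
      ∀ σ ∈ inertia ((Rat.HeightOneSpectrum.primesEquiv (R := 𝓞 ℚ)).symm ⟨3, Nat.prime_three⟩),
        σ ∈ κ.kerSubgroup → σ • βτ = βτ)
    (β : ι → AlgebraicClosure ℚ) (hβ' : ∀ i, β i ^ 3 = a i)
    (k : ι → ℕ) (F : contOneCocycles (discreteTopRep κ.kerSubgroup Ψ))
    (hF : ∀ h : κ.kerSubgroup, ∃ m : ℕ, (h : absoluteGaloisGroup ℚ) • (∏ i, β i ^ k i) =
      ζ₃ ^ m * ∏ i, β i ^ k i ∧ F.1 h = m • y₀) :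
    oneCocycleClass (discreteTopRep κ.kerSubgroup Ψ) F ∈
      unramifiedSelmer κ.kerSubgroup Ψ 3 (↑S₀ : Set (HeightOneSpectrum (𝓞 ℚ))) := by
  haveI : NeZero ((3 : ℕ) : ℚ) := ⟨by norm_num⟩
  have ha0 : ∀ i, a i ≠ 0 := fun i h0 ↦ hn0 i (by
    have := hab i
    rw [h0, zero_mul] at this
    exact_mod_cast this.symm)
  have hβ0 : ∀ i, β i ≠ 0 := fun i h0 ↦ by
    have := hβ' i; rw [h0, zero_pow three_ne_zero] at this; exact ha0 i this.symm
  refine mem_unramifiedSelmer_of_conj_of_mem κ.kerSubgroup 3 F (↑S₀) fun τ ↦ ?_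
  -- conjugate data per unit
  have hτaint : ∀ i, IsIntegral (𝓞 ℚ) (τ • a i) := fun i ↦ isIntegral_smul (haint i) τ
  have hcof : ∀ i, ∃ b' : AlgebraicClosure ℚ, IsIntegral (𝓞 ℚ) b' ∧ (τ • a i) * b' = n i := fun i ↦
    ⟨τ • b i, isIntegral_smul (hbint i) τ, by
      rw [← smul_mul', hab i, absoluteGaloisGroup.smul_def, map_natCast]⟩
  -- good roots of the conjugates
  choose βτ hβτ hβτfix using fun i ↦ hgood i τ
  have hτβ3 : ∀ i, (τ • β i) ^ 3 = τ • a i := fun i ↦ by rw [← smul_pow', hβ' i]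
  have hτa0 : ∀ i, τ • a i ≠ 0 := fun i h0 ↦ by
    obtain ⟨b', -, hb'⟩ := hcof i
    rw [h0, zero_mul] at hb'
    exact hn0 i (by exact_mod_cast hb'.symm)
  have hτβ0 : ∀ i, τ • β i ≠ 0 := fun i h0 ↦ by
    have := hτβ3 i; rw [h0, zero_pow three_ne_zero] at this; exact hτa0 i this.symm
  have hjj : ∀ i, ∃ jj : ℕ, βτ i = ζ₃ ^ jj * (τ • β i) := fun i ↦ by
    have hq' : (βτ i / (τ • β i)) ^ 3 = 1 := by
      rw [div_pow, hβτ i, ← hτβ3 i, div_self (pow_ne_zero _ (hτβ0 i))]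
    obtain ⟨jj, -, hζj⟩ := hζ₃.eq_pow_of_pow_eq_one hq'
    exact ⟨jj, by rw [hζj, div_mul_cancel₀ _ (hτβ0 i)]⟩
  choose jj hjj using hjj
  have hβτ0 : ∀ i, βτ i ≠ 0 := fun i ↦ by
    rw [hjj i]; exact mul_ne_zero (pow_ne_zero _ (hζ₃.ne_zero three_ne_zero)) (hτβ0 i)
  -- `ker κ` fixes `τ a_i` (normality of `ker κ`)
  have hkerτa : ∀ i, ∀ σ ∈ κ.kerSubgroup, σ • (τ • a i) = τ • a i := fun i ↦
    smul_smul_eq_of_normal (haker i) τ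
  -- Kummer cocycles of `τ a_i`
  choose fτ hfτc hfτcoc hfτrel using fun i ↦
    exists_kummerCocycle (p := 3) κ.kerSubgroup hΨ y₀ hy₀3 hζ₃ (hτa0 i) (hkerτa i) (hβτ i)
  choose f₁ hf₁c hf₁coc hf₁rel using fun i ↦
    exists_kummerCocycle (p := 3) κ.kerSubgroup hΨ y₀ hy₀3 hζ₃ (hτa0 i) (hkerτa i) (hτβ3 i)
  set Fτ : absoluteGaloisGroup ℚ → Ψ := fun σ ↦ ∑ i, k i • fτ i σ with hFτdef
  set F₁ : absoluteGaloisGroup ℚ → Ψ := fun σ ↦ ∑ i, k i • f₁ i σ with hF₁def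
  have hFτc' : Continuous Fτ := continuous_finsetSum _ fun i _ ↦ (continuous_nsmul (k i)).comp (hfτc i)
  have hF₁c' : Continuous F₁ := continuous_finsetSum _ fun i _ ↦ (continuous_nsmul (k i)).comp (hf₁c i)
  have hFτcoc' : ∀ σ ∈ κ.kerSubgroup, ∀ σ' ∈ κ.kerSubgroup, Fτ (σ * σ') = Fτ σ + σ • Fτ σ' :=
    fun σ hσ σ' hσ' ↦ by
      simp only [hFτdef, hfτcoc _ σ hσ σ' hσ', nsmul_add, Finset.sum_add_distrib, Finset.smul_sum,
        smul_comm σ]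
  have hF₁coc' : ∀ σ ∈ κ.kerSubgroup, ∀ σ' ∈ κ.kerSubgroup, F₁ (σ * σ') = F₁ σ + σ • F₁ σ' :=
    fun σ hσ σ' hσ' ↦ by
      simp only [hF₁def, hf₁coc _ σ hσ σ' hσ', nsmul_add, Finset.sum_add_distrib, Finset.smul_sum,
        smul_comm σ]
  obtain ⟨Fτc, -, hFτc1, -⟩ := exists_class_of_cocycle κ.kerSubgroup le_rfl Fτ hFτc' hFτcoc'
  obtain ⟨F₁c, -, hF₁c1, -⟩ := exists_class_of_cocycle κ.kerSubgroup le_rfl F₁ hF₁c' hF₁coc'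
  -- products
  set Bp : AlgebraicClosure ℚ := ∏ i, β i ^ k i with hBdef
  have hB0 : Bp ≠ 0 := Finset.prod_ne_zero_iff.mpr fun i _ ↦ pow_ne_zero _ (hβ0 i)
  have hτB : τ • Bp = ∏ i, (τ • β i) ^ k i := by
    rw [hBdef, Finset.smul_prod']
    exact Finset.prod_congr rfl fun i _ ↦ smul_pow' _ _ _
  have hτB0 : τ • Bp ≠ 0 := by
    rw [hτB]; exact Finset.prod_ne_zero_iff.mpr fun i _ ↦ pow_ne_zero _ (hτβ0 i)
  set J : ℕ := ∑ i, jj i * k i with hJ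
  have hprodτ : ∏ i, βτ i ^ k i = ζ₃ ^ J * (τ • Bp) := by
    rw [hτB, hJ, ← Finset.prod_pow_eq_pow_sum, ← Finset.prod_mul_distrib]
    exact Finset.prod_congr rfl fun i _ ↦ by rw [hjj i, mul_pow, ← pow_mul]
  -- vanishing of the good cocycles on `I_v ∩ ker κ`
  have hvanI : ∀ (v : HeightOneSpectrum (𝓞 ℚ)), v ∉ (↑S₀ : Set (HeightOneSpectrum (𝓞 ℚ))) ∨
      ((3 : ℕ) : 𝓞 ℚ) ∈ v.asIdeal → ∀ σ ∈ inertia v, σ ∈ κ.kerSubgroup → ∀ i, fτ i σ = 0 := by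
    intro v hv σ hσ hσker i
    obtain ⟨m, hm, hfm⟩ := hfτrel i σ hσker
    have hfix : σ • βτ i = βτ i := by
      by_cases hv3 : ((3 : ℕ) : 𝓞 ℚ) ∈ v.asIdeal
      · have hvv : v = (Rat.HeightOneSpectrum.primesEquiv (R := 𝓞 ℚ)).symm ⟨3, Nat.prime_three⟩ := by
          have h1 := (Literature.NumberTheory.Automorphic.BCDT.natCast_mem_asIdeal_iff_primesEquiv_eq
            v hp.out).mp hv3
          exact Rat.HeightOneSpectrum.primesEquiv.injective
            (by rw [Equiv.apply_symm_apply]; exact Subtype.ext h1)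
        rw [hvv] at hσ
        exact hβτfix i σ hσ hσker
      · have hvS : v ∉ (↑S₀ : Set (HeightOneSpectrum (𝓞 ℚ))) := hv.resolve_right hv3
        obtain ⟨b', hb'int, hb'⟩ := hcof i
        exact smul_eq_self_of_mem_inertia_of_pow_eq_of_dvd (p := 3) hζ₃ (hτaint i) hb'int hb'
          (hβτ i) hv3 (fun hnv ↦ hvS (hnS i v hnv)) hσ (hkerτa i σ hσker)
    rw [hfix] at hm
    have hζm : ζ₃ ^ m = 1 := by
      have h1 : ζ₃ ^ m * βτ i = 1 * βτ i := by rw [one_mul]; exact hm.symm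
      exact mul_right_cancel₀ (hβτ0 i) h1
    obtain ⟨kk, rfl⟩ := (hζ₃.pow_eq_one_iff_dvd m).mp hζm
    rw [hfm, mul_nsmul, hy₀3, nsmul_zero]
  refine ⟨Fτ, Fτc, hFτc1, ?_, ?_, ?_⟩
  · have e1 : conjH1 κ.kerSubgroup Ψ τ
        (oneCocycleClass (discreteTopRep κ.kerSubgroup Ψ) F) =
        oneCocycleClass (discreteTopRep κ.kerSubgroup Ψ) F₁c :=
      conjH1_eq_of_kummer (p := 3) κ.kerSubgroup hΨ hy₀3 hζ₃ hB0 τ F F₁c hF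
        (fun h ↦ by
          obtain ⟨m, hm, hFm⟩ := rel_sum_at Finset.univ y₀ (fun i ↦ τ • β i) f₁ h
            (fun i _ ↦ hf₁rel i h h.2) (fun i ↦ k i)
          refine ⟨m, by rw [hτB]; exact hm, by rw [hF₁c1]; exact hFm⟩)
    have e2 : oneCocycleClass (discreteTopRep κ.kerSubgroup Ψ) Fτc =
        oneCocycleClass (discreteTopRep κ.kerSubgroup Ψ) F₁c :=
      class_eq_of_root_mul_pow (p := 3) κ.kerSubgroup hΨ hy₀3 hζ₃ hτB0 J F₁c Fτc
        (fun h ↦ by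
          obtain ⟨m, hm, hFm⟩ := rel_sum_at Finset.univ y₀ (fun i ↦ τ • β i) f₁ h
            (fun i _ ↦ hf₁rel i h h.2) (fun i ↦ k i)
          refine ⟨m, by rw [hτB]; exact hm, by rw [hF₁c1]; exact hFm⟩)
        (fun h ↦ by
          obtain ⟨m, hm, hFm⟩ := rel_sum_at Finset.univ y₀ βτ fτ h
            (fun i _ ↦ hfτrel i h h.2) (fun i ↦ k i)
          refine ⟨m, by rw [← hprodτ]; exact hm, by rw [hFτc1]; exact hFm⟩)
    rw [e1, e2]
  · intro v hvS σ hσ hσker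
    simp only [hFτdef]
    exact Finset.sum_eq_zero fun i _ ↦ by rw [hvanI v (Or.inl hvS) σ hσ hσker i, nsmul_zero]
  · intro v hv3 σ hσ hσker
    simp only [hFτdef]
    exact Finset.sum_eq_zero fun i _ ↦ by rw [hvanI v (Or.inr hv3) σ hσ hσker i, nsmul_zero]

end KummerFamily

/-! ### §2 The U-side lower bound from an abstract family -/

section Main

open NumberField IsDedekindDomain Field WeierstrassCurve Finset
  Literature.NumberTheory.GaloisRepresentations
  Literature.NumberTheory.EllipticCurves
  Literature.NumberTheory.EllipticCurves.GreenbergSelmer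
  Literature.NumberTheory.EllipticCurves.GreenbergVatsal2000
  Literature.NumberTheory.EllipticCurves.Rank1Residual
  Literature.NumberTheory.NumberFields
  Summit.BirchSwinnertonDyer.Rank1Residual.X2.ResidualDevissageModules
  Summit.BirchSwinnertonDyer.Rank1Residual.X2.ResidualDevissageLine
  KummerLineClasses KummerLayerClasses KummerFamily

variable {W : WeierstrassCurve ℚ} [W.IsElliptic]

/-- **LOWER BOUND for GV's `U(W[3]/Φ₀)` from an ABSTRACT family of `Σ₀`-units.** `κ` a `ℤ₃`-extension of
`ℚ`, `Φ₀ ≤ W[3]` a rational line fixed pointwise (so `Ψ = W[3]/Φ₀` is the `ω`-line), `G' ≥ ker κ` a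
subgroup of `Γ_ℚ`; a finite family of algebraic integers `a_i` fixed by `G'`, integral cofactors `b_i`,
`a_i b_i = n_i ≠ 0` with the primes of `n_i` in `S₀`; for every `τ ∈ Γ_ℚ` a cube root of `τ a_i` fixed by
`I_{v₃} ∩ ker κ`; and the independence «`γ³ = ∏ a_i^{d_i}` with `γ` fixed by `G'` forces `d = 0`».
Then `3^{#ι} ≤ #U` (`residualQuotSelmer`, assumed finite). See the module docstring.
[cite: GreenbergVatsal2000, §2 pp. 28–30] [cite: SerreLocalFields1979, Ch. X §3] [cite: Washington1997, §13.1] -/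
theorem _root_.Summit.BirchSwinnertonDyer.Rank1Residual.Additive.X3Branch.pow_card_le_natCard_residualQuotSelmer_of_trivialLine_of_family
    [hp : Fact (Nat.Prime 3)] (κ : ZpExtension ℚ 3) (S₀ : Finset (HeightOneSpectrum (𝓞 ℚ)))
    {Φ₀ : AddSubgroup (W.geomTorsion ((3 : ℕ) : ℤ))} (hΦ : IsRationalLine W 3 Φ₀)
    (htriv : ∀ (σ : absoluteGaloisGroup ℚ) (Pt : geomTorsion W ((3 : ℕ) : ℤ)), Pt ∈ Φ₀ → σ • Pt = Pt)
    (G' : Subgroup (absoluteGaloisGroup ℚ)) (hG' : κ.kerSubgroup ≤ G')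
    {ι : Type} [Fintype ι] [DecidableEq ι] (a b : ι → AlgebraicClosure ℚ)
    (haint : ∀ i, IsIntegral (𝓞 ℚ) (a i)) (hbint : ∀ i, IsIntegral (𝓞 ℚ) (b i))
    (n : ι → ℕ) (hn0 : ∀ i, n i ≠ 0) (hab : ∀ i, a i * b i = (n i : AlgebraicClosure ℚ))
    (hnS : ∀ i (v : HeightOneSpectrum (𝓞 ℚ)), ((n i : ℕ) : 𝓞 ℚ) ∈ v.asIdeal → v ∈ S₀)
    (hG'a : ∀ i, ∀ σ ∈ G', σ • a i = a i)
    (hgood : ∀ i (τ : absoluteGaloisGroup ℚ), ∃ βτ : AlgebraicClosure ℚ, βτ ^ 3 = τ • a i ∧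
      ∀ σ ∈ inertia ((Rat.HeightOneSpectrum.primesEquiv (R := 𝓞 ℚ)).symm ⟨3, Nat.prime_three⟩),
        σ ∈ κ.kerSubgroup → σ • βτ = βτ)
    (hindep : ∀ (d : ι → ZMod 3) (γ : AlgebraicClosure ℚ), (∀ σ ∈ G', σ • γ = γ) →
      γ ^ 3 = ∏ i, a i ^ (d i).val → d = 0)
    [Finite (residualQuotSelmer W 3 κ S₀ Φ₀ hΦ)] :
    3 ^ Fintype.card ι ≤ Nat.card (residualQuotSelmer W 3 κ S₀ Φ₀ hΦ) := by
  haveI : NeZero ((3 : ℕ) : ℚ) := ⟨by norm_num⟩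
  obtain ⟨ζ₃, hζ₃⟩ := HasEnoughRootsOfUnity.exists_primitiveRoot (AlgebraicClosure ℚ) 3
  -- the `ω`-line `Ψ = W[3]/Φ₀` with a generator `y₀`
  have hΨ := quot_smul_eq_cyclotomic_of_trivialLine (p := 3) hΦ htriv
  obtain ⟨y₀, hy₀, hgen⟩ := exists_generator_quot (p := 3) hΦ
  have hy₀3 : 3 • y₀ = 0 := by
    have h := addOrderOf_nsmul_eq_zero y₀
    rwa [hy₀] at h
  have ha0 : ∀ i, a i ≠ 0 := fun i h0 ↦ hn0 i (by
    have := hab i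
    rw [h0, zero_mul] at this
    exact_mod_cast this.symm)
  have hkera : ∀ i, ∀ σ ∈ κ.kerSubgroup, σ • a i = a i := fun i σ hσ ↦ hG'a i σ (hG' hσ)
  -- cube roots (for `τ = 1`) and Kummer cocycles on `ker κ`
  have hroots : ∀ i, ∃ βi : AlgebraicClosure ℚ, βi ^ 3 = a i := fun i ↦ by
    obtain ⟨βi, hβi, -⟩ := hgood i 1
    exact ⟨βi, by rw [hβi, one_smul]⟩
  choose β hβ' using hroots
  have hβ0 : ∀ i, β i ≠ 0 := fun i h0 ↦ by
    have := hβ' i; rw [h0, zero_pow three_ne_zero] at this; exact ha0 i this.symm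
  choose f hfc hfcoc hfrel using fun i ↦
    exists_kummerCocycle (p := 3) κ.kerSubgroup hΨ y₀ hy₀3 hζ₃ (ha0 i) (hkera i) (hβ' i)
  -- `3`-torsion bookkeeping in `Ψ`
  have h3Ψ : ∀ y : (lineSub Φ₀ hΦ).Quot, 3 • y = 0 := fun y ↦ by
    obtain ⟨t, rfl⟩ := hgen y
    rw [← mul_nsmul, mul_comm, mul_nsmul, hy₀3, nsmul_zero]
  have hmodΨ : ∀ (y : (lineSub Φ₀ hΦ).Quot) (u v : ℕ), (u : ZMod 3) = v → u • y = v • y :=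
    fun y u v h ↦ by
      rw [nsmul_eq_mod_nsmul u (h3Ψ y), nsmul_eq_mod_nsmul v (h3Ψ y),
        (ZMod.natCast_eq_natCast_iff' u v 3).mp h]
  have hsubΨ : ∀ (y : (lineSub Φ₀ hΦ).Quot) (k k' : ZMod 3),
      k.val • y - k'.val • y = (k - k').val • y := fun y k k' ↦ by
    rw [sub_eq_iff_eq_add, ← add_nsmul]
    apply hmodΨ
    push_cast
    simp only [ZMod.natCast_val, ZMod.cast_id', id_eq, sub_add_cancel]
  -- the combinations `F k = Σ k_i f_i`
  set F : (ι → ZMod 3) → absoluteGaloisGroup ℚ → (lineSub Φ₀ hΦ).Quot :=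
    fun k σ ↦ ∑ i, (k i).val • f i σ with hFdef
  haveI : ContinuousAdd (lineSub Φ₀ hΦ).Quot := ⟨continuous_of_discreteTopology⟩
  have hFc : ∀ k, Continuous (F k) := fun k ↦
    continuous_finsetSum _ fun i _ ↦ (continuous_nsmul (k i).val).comp (hfc i)
  have hFcoc : ∀ k, ∀ σ ∈ κ.kerSubgroup, ∀ τ ∈ κ.kerSubgroup, F k (σ * τ) = F k σ + σ • F k τ :=
    fun k σ hσ τ hτ ↦ by
      simp only [hFdef, hfcoc _ σ hσ τ hτ, nsmul_add, Finset.sum_add_distrib, Finset.smul_sum, smul_comm σ]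
  have hFrel : ∀ k, ∀ σ ∈ κ.kerSubgroup, ∃ m : ℕ,
      σ • (∏ i, β i ^ (k i).val) = ζ₃ ^ m * ∏ i, β i ^ (k i).val ∧ F k σ = m • y₀ :=
    fun k σ hσ ↦ rel_sum_at Finset.univ y₀ β f σ (fun i _ ↦ hfrel i σ hσ) (fun i ↦ (k i).val)
  have hFsub : ∀ k k' σ, F k σ - F k' σ = F (k - k') σ := fun k k' σ ↦ by
    simp only [hFdef, ← Finset.sum_sub_distrib, hsubΨ, Pi.sub_apply]
  -- the classes `c k = [F k|_{G_{ℚ_∞}}]`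
  choose Fc cls hFc1 hcls using fun k ↦
    exists_class_of_cocycle κ.kerSubgroup le_rfl (F k) (hFc k) (hFcoc k)
  -- MEMBERSHIP in `U` (§1)
  have hmem : ∀ k, cls k ∈ unramifiedSelmer κ.kerSubgroup (lineSub Φ₀ hΦ).Quot 3
      (↑S₀ : Set (HeightOneSpectrum (𝓞 ℚ))) := fun k ↦ by
    rw [hcls k]
    exact kummerSumClass_mem_unramifiedSelmer_of_goodRoots κ S₀ hΨ hy₀3 hζ₃ a b haint hbint n hn0
      hab hnS hkera hgood β hβ' (fun i ↦ (k i).val) (Fc k)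
      (fun h ↦ by
        obtain ⟨m, hm, hFm⟩ := hFrel k h h.2
        exact ⟨m, hm, by rw [hFc1]; exact hFm⟩)
  -- INJECTIVITY: a vanishing class forces `d = 0`
  have hzero : ∀ d : ι → ZMod 3, cls d = 0 → d = 0 := by
    intro d hd
    rw [hcls d, oneCocycleClass_eq_zero_iff] at hd
    obtain ⟨y, hy⟩ := hd
    have hcob : ∀ h ∈ κ.kerSubgroup, F d h = h • y - y := fun h hh ↦ by
      have := hy ⟨h, hh⟩
      rw [hFc1 d ⟨h, hh⟩] at this
      exact this
    set A : AlgebraicClosure ℚ := ∏ i, a i ^ (d i).val with hA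
    have hA0 : A ≠ 0 := Finset.prod_ne_zero_iff.mpr fun i _ ↦ pow_ne_zero _ (ha0 i)
    have hBA : (∏ i, β i ^ (d i).val) ^ 3 = A := by
      rw [← Finset.prod_pow, hA]
      exact Finset.prod_congr rfl fun i _ ↦ by rw [← pow_mul, mul_comm, pow_mul, hβ' i]
    obtain ⟨γ, hγ, hγfix⟩ := KummerLayerClasses.exists_fixed_root_of_coboundary (p := 3) hΨ hy₀ hgen
      hζ₃ hBA (hFrel d) κ.kerSubgroup le_rfl hcob
    -- `γ` is fixed by `G'`
    have hAG : ∀ σ ∈ G', σ • A = A := fun σ hσ ↦ by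
      rw [hA, Finset.smul_prod']
      exact Finset.prod_congr rfl fun i _ ↦ by rw [smul_pow', hG'a i σ hσ]
    have hγG : ∀ σ ∈ G', σ • γ = γ := fun σ hσ ↦
      smul_eq_self_of_fixed_kerSubgroup (p := 3) (by decide) κ hζ₃ hA0 hγ hAG hγfix hσ
    exact hindep d γ hγG (by rw [hγ, hA])
  -- COUNTING
  haveI hfin : Finite (unramifiedSelmer κ.kerSubgroup (lineSub Φ₀ hΦ).Quot 3
      (↑S₀ : Set (HeightOneSpectrum (𝓞 ℚ)))) := ‹Finite (residualQuotSelmer W 3 κ S₀ Φ₀ hΦ)›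
  let Fmap : (ι → ZMod 3) → unramifiedSelmer κ.kerSubgroup (lineSub Φ₀ hΦ).Quot 3
      (↑S₀ : Set (HeightOneSpectrum (𝓞 ℚ))) := fun k ↦ ⟨cls k, hmem k⟩
  have hinj : Function.Injective Fmap := by
    intro k k' hkk'
    have h1 : cls k = cls k' := congrArg Subtype.val hkk'
    have h2 : cls (k - k') = 0 := by
      have e' : Fc k - Fc k' = Fc (k - k') := by
        apply Subtype.ext
        ext h
        change (Fc k).1 h - (Fc k').1 h = (Fc (k - k')).1 h
        rw [hFc1, hFc1, hFc1, hFsub]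
      rw [hcls, ← e', oneCocycleClass_sub, ← hcls, ← hcls, h1, sub_self]
    exact sub_eq_zero.mp (hzero _ h2)
  have hcard := Nat.card_le_card_of_injective Fmap hinj
  rw [Nat.card_fun, Nat.card_zmod, Nat.card_eq_fintype_card] at hcard
  exact hcard

end Main

end Summit.BirchSwinnertonDyer.Rank1Residual.Additive

end
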